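import Summits.BirchSwinnertonDyer.BirchSwinnertonDyer.Theorems.ManinLocalTwoThreeNineShiftResidual
import Summits.BirchSwinnertonDyer.BirchSwinnertonDyer.Theorems.ManinLocalTwoThreeThreeShiftAntiDescentThree
import Summits.BirchSwinnertonDyer.BirchSwinnertonDyer.Theorems.ManinLocalTwoThreeThreeShiftAmalgam
import Summits.BirchSwinnertonDyer.Rank1Residual.ManinAdditive.NineShiftConjDefect
import HarnessLib

/-!
# The nine-shift equaliser law modulo the two depth-27 `K₃,₃` steps
# (route `ManinLocalTwoThree`, cell bsd-f2-manin; crux C3 `ManinPrimeToThreeAtNine` stmt-BirchSwinnertonDyer-22968; prover seat p3 gen 10)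

Assembly of tonight's landings: the prime-to-3 base E-es-102 is a THEOREM (`threeShiftBasePrimeToThree_holds`, seat p2, via
Serre's amalgam E-es-107 `threeShiftAmalgamExtensionAll_holds`), the anti-invariant step `3N₀ → 9N₀` is es's THEOREM V
(`ThreeShiftDescent.threeShiftAntiInvariantDescent_of_not_three_dvd`, landed p681331), the cube steps E-es-103/104 and step nine
E-es-105 are theorems of this seat.  Hence, with `nineShiftInvariantIsDiamond_of_steps` (`…NineShiftResidual.lean`):
* **`antiInvariantStepNine_holds : AntiInvariantStepNine`** (E-p3-S9⁻ BY NAME);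
* **`nineShiftInvariantIsDiamond_of_depth27_steps : ThreeShiftStepTwentySeven → AntiInvariantStepTwentySeven →
  NineShiftInvariantIsDiamond`** — E-es-94♯ at EVERY `9 ∣ N` follows from the two single-depth step laws at `9N₀ → 27N₀`
  (E-p3-S27 = THEOREM III at `9 ∥ M`, E-p3-S27⁻ = THEOREM III″ at `9 ∥ M`; both ⟸ the Heisenberg lift on `Γ₀(9N₀)`, es E-es-109
  ⟸ E-es-108 Kulkarni, lane of seat p1), and NOTHING ELSE;
* the same two hypotheses give es's (CD₉) `ConjDefectLawNine` and the squarefull-habitat conclusion `¬ 3 ∣ c` of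
  `NineShiftConjDefect.not_three_dvd_maninConstant_of_nineShiftInvariantIsDiamond` (`…_of_depth27_steps`).
Nothing about BSD or Manin's conjecture is asserted here; C3 stays OPEN.
-/

set_option autoImplicit false
set_option linter.dupNamespace false

open scoped MatrixGroups

open CongruenceSubgroup Matrix.SpecialLinearGroup Literature.NumberTheory.EllipticCurves
  Literature.NumberTheory.EllipticCurves.ModularForms
  Summit.BirchSwinnertonDyer.Rank1Residual.ManinAdditive.NineShiftEqualiser
  Summit.BirchSwinnertonDyer.Rank1Residual.ManinAdditive.DegeneracyOrbit
  Summit.BirchSwinnertonDyer.Rank1Residual.ManinAdditive.KatoCurve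

namespace Summit.BirchSwinnertonDyer.BirchSwinnertonDyer.Theorems.ManinLocalTwoThree

/-- **E-p3-S9⁻ PROVED**: `K₃⁻(3N₀) = 0 ⟹ K₃⁻(9N₀) = 0` (`3 ∤ N₀`), from es's THEOREM V
(`threeShiftAntiInvariantDescent_of_not_three_dvd`). [new: es g23 THEOREM V, MEMO-es §37.13] -/
theorem antiInvariantStepNine_holds : AntiInvariantStepNine := by
  intro N₀ _ h3 h3N
  rw [show 9 * N₀ = 3 * (3 * N₀) by ring]
  intro ψ hadd hanti γ
  obtain ⟨w, hwa, hwi, hr⟩ := ThreeShiftDescent.threeShiftAntiInvariantDescent_of_not_three_dvd N₀ h3 ψ hadd hanti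
  exact eq_zero_of_restrictsFrom ⟨3, by ring⟩ hr (h3N w hwa hwi) γ

/-- **E-es-94♯ ⟸ the two depth-27 `K₃,₃` steps.**  `NineShiftInvariantIsDiamond` follows from E-p3-S27
(`ThreeShiftStepTwentySeven`) and E-p3-S27⁻ (`AntiInvariantStepTwentySeven`) alone: the base E-es-102, the cube steps
E-es-103/104, step nine E-es-105, the anti step `3 → 9` (THEOREM V), THEOREM III above depth 27 and III′ are theorems of the tree.
[new: composition of the proved nodes] -/
theorem nineShiftInvariantIsDiamond_of_depth27_steps (hS27 : ThreeShiftStepTwentySeven)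
    (hS27m : AntiInvariantStepTwentySeven) : NineShiftInvariantIsDiamond :=
  nineShiftInvariantIsDiamond_of_steps threeShiftBasePrimeToThree_holds hS27 antiInvariantStepNine_holds hS27m

/-- (CD₉) `ConjDefectLawNine` ⟸ the two depth-27 steps (es's PROVED edge `conjDefectLawNine_of_nineShiftInvariantIsDiamond`).
[new: composition of the proved nodes] -/
theorem conjDefectLawNine_of_depth27_steps (hS27 : ThreeShiftStepTwentySeven) (hS27m : AntiInvariantStepTwentySeven) :
    ConjDefectLawNine :=
  conjDefectLawNine_of_nineShiftInvariantIsDiamond (nineShiftInvariantIsDiamond_of_depth27_steps hS27 hS27m)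

open WeierstrassCurve in
/-- **The squarefull-habitat conclusion of crux C3 modulo the two depth-27 steps**: for an optimal parametrisation with
Kato's fact at `3`, additive reduction at `3`, `9 ∣ N`, `N` squarefull and plus-index prime to `3`, the Manin constant is prime
to `3` — es's edge `not_three_dvd_maninConstant_of_nineShiftInvariantIsDiamond` with E-es-94♯ supplied by
`nineShiftInvariantIsDiamond_of_depth27_steps`. [new: composition of the proved nodes] -/
theorem not_three_dvd_maninConstant_of_depth27_steps (hS27 : ThreeShiftStepTwentySeven)
    (hS27m : AntiInvariantStepTwentySeven)
    (W : WeierstrassCurve ℚ) [W.IsElliptic] [W.IsGloballyMinimal] {N : ℕ} [NeZero N]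
    (D : ModularParametrizationData W N) (hF : KatoFactThreeAt W D.f)
    (hopt : ∀ z ∈ D.L.lattice, ∃ w ∈ periodLattice D.f, z = D.c * w)
    (h3g : ¬ W.HasGoodReductionAtPrime 3) (h3m : ¬ W.HasMultiplicativeReductionAtPrime 3)
    (h9 : 3 ^ 2 ∣ N) (hsq : IsSquarefull N) (hd : PlusIndexPrimeTo 3 D.f) : ¬ (3 : ℤ) ∣ D.c :=
  not_three_dvd_maninConstant_of_nineShiftInvariantIsDiamond (nineShiftInvariantIsDiamond_of_depth27_steps hS27 hS27m)
    W D hF hopt h3g h3m h9 hsq hd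

end Summit.BirchSwinnertonDyer.BirchSwinnertonDyer.Theorems.ManinLocalTwoThree
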